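import Mathlib
import HarnessLib
import Summits.Langlands.Langlands.Theses.GoldenFieldSerre

/-!
# Birth skeleton (BC3) for crux stmt-Langlands-17048
`Summit.Langlands.Langlands.Theses.GoldenFieldSerre.WeightCyclesGolden` — line `birth`

THE CRUX (shape checked definitionally by the crux-attack refuter, CRUX-ATTACK.md 2026-08-17):
`WeightCyclesGolden ≡ MTAnchor → LevelOneModThreeGolden → SchoofAnchor → LevelOneSerreGolden`, where
* `MTAnchor` (Moon–Taguchi 2008, Thm): over the golden field `F = ℚ(√5)` every continuous
  `ρ̄ : Γ_F → GL₂(k)`, `char k = 2`, unramified outside `2` is reducible;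
* `LevelOneModThreeGolden` (crux #2 of the route): the `p = 3` anchor (solvable image);
* `SchoofAnchor` (Schoof 2003, Thm 2.1(I), consumed form): no irreducible `ρ : Γ_F → GL₂(ℚ̄₂)`
  unramified outside `2` and crystalline with Hodge–Tate weights in `[0,1]` at `(2)`;
* `LevelOneSerreGolden`: LEVEL-ONE Serre over `F` — for every prime `p`, every irreducible totally odd
  `ρ̄ : Γ_F → GL₂(k)`, `char k = p`, unramified outside `p` is modular (a.e. Frobenius characteristic
  polynomials = reductions of the Hecke polynomials of a cuspidal regular algebraic `π` of `GL₂(𝔸_F)`).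

THE LINE = Khare's level-one induction (Khare2006 Thm 1.1; KhareWintenberger2009 Thm 3.2, §7–8)
transplanted to `F` under split-prime discipline (route header, TWO-LAYER PLAN):
`LevelOneAt p` := level-one Serre over the golden field in residual characteristic `p` (the crux's
conclusion at one prime, verbatim).  Then

* `p = 2` is VACUOUS from `MTAnchor` (proved inside the composition — pure logic, no stub);
* `stub_levelOneModThree_modular` : `LevelOneModThreeGolden → LevelOneAt 3` — consumption of the
  `p = 3` anchor: a solvable-image, irreducible, totally odd `ρ̄ : Γ_F → GL₂(𝔽̄₃)` is modular by a
  REGULAR algebraic cuspidal `π` (Langlands–Tunnell over the totally real field `F` + the weight-one →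
  regular-weight congruence, Deligne–Serre/Wiles `θ`-trick over `F`); size M/L;
* `stub_levelOneFiveSeven` : the anchors `⇒ LevelOneAt 5 ∧ LevelOneAt 7` — the Khare–Wintenberger
  (Annals 2009, Thm 1.1) small-prime level-one cases transplanted to `F`: minimal weight-two /
  crystalline lifts into compatible systems, the weight-two level-one corner killed by `SchoofAnchor`,
  the prime-level semistable corners (`𝔭 ∣ 5, 7`) by Schoof-type non-existence over `ℚ(√5)`
  (Schoof2011) and modularity lifting at split auxiliary primes; size XL (the route's flagged corner);
* `stub_weightCycleStep` : the anchors `⇒ ∀ P prime, 7 < P → (∀ p prime, p < P → LevelOneAt p) →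
  LevelOneAt P` — Khare's weight-cycle induction step over `F` (Khare2006 §§3–5; KW2009 Thm 3.2 with
  Thm 5.1-type lifts, auxiliary primes SPLIT in `F`, pot-BT / crystalline low-weight MLT:
  KisinModuli2009, GeeKisin2014, GeeLiuSavitt2015; Skinner–Wiles for forced-ordinary reducible
  detours); size XL.

Composition `WeightCyclesGolden_of : _Goal.stub₁ → _Goal.stub₂ → _Goal.stub₃ → WeightCyclesGolden`
(hypotheses = the stub statements BY NAME, `_Goal.stub_* := type_of% @stub_*`; kernel-checked, no
`sorry` outside the three `stub_*`): strong induction on `p`; `p = 2` from `MTAnchor` (vacuous),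
`p = 3` from stub₁, `p ∈ {5, 7}` from stub₂, `p > 7` from stub₃ and the induction hypothesis;
`4, 6` are not prime.  Every hypothesis of the crux is consumed: `MTAnchor` at `p = 2` and in
stubs ₂/₃, `LevelOneModThreeGolden` in stubs ₁/₂, `SchoofAnchor` in stubs ₂/₃.

Disproof used: none exists for this crux (`ledger crux ls stmt-Langlands-17048`: no workfiles, no
`Disproof.lean`, no `Negative/` lemma, 2026-08-17); `ledger negatives --problem Langlands` has no
statement of the stubs' shape.  No `_false_without_` theorem to honour.

BC3 probes (registrar folder `bc/stub_*_probe_{crux,summit}.lean`, 2026-08-17): for each of the three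
stub signatures `S` and each target `T ∈ {WeightCyclesGolden, _root_.Langlands}`, the prescribed
`set_option maxHeartbeats 400000 in example : S → T := by first | exact? | simpa | aesop` FAILS
(6/6: `exact?` could not close the goal, `simpa` fails, aesop fails after exhaustive search), and so
does each battery alone (`exact?`, `simpa`, `simpa [defs]`, `unfold; simpa`, `aesop`: 30/30 fail) —
no stub is cheaply the crux or the summit.
-/

set_option linter.dupNamespace false

noncomputable section

namespace Summit.Langlands.Langlands.Cruxes.WeightCyclesGolden.Birth

open Summit.Langlands.Langlands.Theses.GoldenFieldSerre

/-! ## 0. Line vocabulary (each clause verbatim from the crux) -/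

/-- The Moon–Taguchi anchor = hypothesis 1 of `WeightCyclesGolden`, verbatim: over the golden field
every continuous `ρ̄ : Γ_F → GL₂(k)`, `char k = 2`, unramified outside `2` is reducible. -/
def MTAnchor : Prop :=
  ∀ (F : Type) [Field F] [NumberField F], Module.finrank ℚ F = 2 → (∃ a : F, a ^ 2 = 5) →
    ∀ (k : Type) [Field k] [CharP k 2] [IsAlgClosed k] [TopologicalSpace k] [DiscreteTopology k],
    ∀ ρ : Literature.NumberTheory.GaloisRepresentations.FramedGaloisRep F k 2,
      (∀ v : IsDedekindDomain.HeightOneSpectrum (NumberField.RingOfIntegers F),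
        ((2 : ℕ) : NumberField.RingOfIntegers F) ∉ v.asIdeal → ρ.IsUnramifiedAt v) →
      ¬ Literature.NumberTheory.GaloisRepresentations.FramedRep.IsIrreducible ρ

/-- The Schoof anchor = hypothesis 3 of `WeightCyclesGolden`, verbatim (consumed form of Schoof 2003,
Thm 2.1(I), `f = 5`, `p = 2`): no irreducible `ρ : Γ_F → GL₂(ℚ̄₂)` unramified outside `2` and
crystalline with Hodge–Tate weights in `[0,1]` at the place above `2` (pinned Fontaine datum). -/
def SchoofAnchor : Prop :=
  ∀ (F : Type) [Field F] [NumberField F], Module.finrank ℚ F = 2 → (∃ a : F, a ^ 2 = 5) →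
    ∀ ρ : Literature.NumberTheory.GaloisRepresentations.FramedGaloisRep F (PadicAlgCl 2) 2,
      (∀ v : IsDedekindDomain.HeightOneSpectrum (NumberField.RingOfIntegers F),
        ((2 : ℕ) : NumberField.RingOfIntegers F) ∉ v.asIdeal → ρ.IsUnramifiedAt v) →
      (∀ (v : IsDedekindDomain.HeightOneSpectrum (NumberField.RingOfIntegers F))
        (hv : ((2 : ℕ) : NumberField.RingOfIntegers F) ∈ v.asIdeal),
        (Literature.NumberTheory.PAdicHodge.fontainePstAdicCompletion v 2 hv).IsCrystallineFramed
            (ρ.toLocal v) ∧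
          (Literature.NumberTheory.PAdicHodge.fontainePstAdicCompletion v 2 hv).IsDeRhamWithWeightsIn
            0 1 (ρ.toLocal v)) →
      ¬ ρ.toGaloisRep.IsIrreducible

/-- Level-one Serre over the golden field IN RESIDUAL CHARACTERISTIC `p` = the conclusion of
`WeightCyclesGolden` at one prime, verbatim: every irreducible totally odd `ρ̄ : Γ_F → GL₂(k)`,
`char k = p`, unramified outside `p` is modular (a.e. Frobenius characteristic polynomials are the
mod-`𝔓` reductions of the arithmetically normalised Hecke polynomials of a cuspidal regular algebraic
`π` of `GL₂(𝔸_F)`). -/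
def LevelOneAt (p : ℕ) : Prop :=
  ∀ [Fact p.Prime], ∀ (F : Type) [Field F] [NumberField F], Module.finrank ℚ F = 2 →
    (∃ a : F, a ^ 2 = 5) →
    ∀ (k : Type) [Field k] [CharP k p] [IsAlgClosed k] [TopologicalSpace k] [DiscreteTopology k],
    ∀ ρ : Literature.NumberTheory.GaloisRepresentations.FramedGaloisRep F k 2,
      Literature.NumberTheory.GaloisRepresentations.FramedRep.IsIrreducible ρ → ρ.IsOdd →
      (∀ v : IsDedekindDomain.HeightOneSpectrum (NumberField.RingOfIntegers F),
        ((p : ℕ) : NumberField.RingOfIntegers F) ∉ v.asIdeal → ρ.IsUnramifiedAt v) →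
      ∃ (hcpt : Literature.NumberTheory.Automorphic.isCompact_glFiniteIntegralLevel 2 F)
        (π : Literature.NumberTheory.Automorphic.CuspidalAutomorphicRepData 2 F hcpt)
        (ι : PadicAlgCl p ≃+* ℂ)
        (red : (Valued.v : Valuation (PadicAlgCl p) NNReal).valuationSubring →+* k),
        π.1.IsRegularAlgebraic ∧ ∀ᶠ w in Filter.cofinite, ∃ α : Multiset ℂ,
          π.1.HasSatakeParamAt w α ∧
          ∃ P₀ : Polynomial (Valued.v : Valuation (PadicAlgCl p) NNReal).valuationSubring,
            P₀.map (Valued.v : Valuation (PadicAlgCl p) NNReal).valuationSubring.subtype =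
              Literature.NumberTheory.Automorphic.arithFrobPolyOfSatake ι w.residueCard 2 α ∧
            ρ.IsUnramifiedAt w ∧ ρ.HasFrobCharpolyAt w (P₀.map red)

/-- The crux is, up to binder order (`Fact p.Prime` vs `p.Prime`, `p` before `F`),
`anchors ⇒ ∀ p prime, LevelOneAt p`; used by the composition. -/
theorem crux_iff :
    WeightCyclesGolden ↔
      (MTAnchor → LevelOneModThreeGolden → SchoofAnchor → ∀ p : ℕ, p.Prime → LevelOneAt p) := by
  constructor
  · intro h hMT h3 hS p hp _ F _ _ hF h5 k _ _ _ _ _ ρ hirr hodd hunr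
    exact h hMT h3 hS F hF h5 p k ρ hirr hodd hunr
  · intro h hMT h3 hS F _ _ hF h5 p _ k _ _ _ _ _ ρ hirr hodd hunr
    exact h hMT h3 hS p (Fact.out) F hF h5 k ρ hirr hodd hunr

/-! ## 1. The open stubs -/

/-- **STUB 1 — consumption of the `p = 3` anchor (Langlands–Tunnell over the golden field).**
`LevelOneModThreeGolden` says every irreducible totally odd level-one `ρ̄ : Γ_F → GL₂(𝔽̄₃)` has
SOLVABLE image; this stub turns that into modularity by a REGULAR algebraic cuspidal `π` of
`GL₂(𝔸_F)`: the image `H = ρ̄(Γ_F) ⊂ GL₂(k)` is finite (discrete `k`) and solvable, hence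
`3`-solvable, so by Fong–Swan the Brauer character of `ρ̄` lifts to an ordinary character: `ρ̄` is
the reduction of an Artin representation `ρ : Γ_F → GL₂(𝒪) ⊂ GL₂(ℂ)` with the same (solvable)
image quotient, totally odd because `det ρ(c)` lifts `det ρ̄(c) = -1 ≠ 1` (char `3`); solvable +
irreducible ⇒ projectively dihedral / `A₄` / `S₄`, so `ρ` is automorphic — a holomorphic Hilbert
cusp form of parallel weight one over the totally real `F` (dihedral: Hecke / automorphic
induction, Jacquet–Langlands §12; tetrahedral / octahedral: Langlands 1980, Tunnell 1981, valid
over every number field); finally weight one ⇒ a congruent cuspidal `π'` of REGULAR (parallel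
`≥ 2`) weight by multiplying by a modular form `≡ 1 (mod 3)` (a lift of a power of the Hasse
invariant / an Eisenstein series) and Deligne–Serre lifting of systems of Hecke eigenvalues over
`F` (Wiles 1988 §1 for Hilbert modular forms), whose `3`-adic Galois representation
(Carayol / Taylor / HLTT normalisation `arithFrobPolyOfSatake ι q 2 α`, cf. the tree's
`exists_galoisRep_of_regularAlgebraic`) reduces to `ρ̄` at almost all places (Chebotarev +
Brauer–Nesbitt).  Why it might fail to close soon: Fong–Swan, Langlands–Tunnell over `F` and the
Deligne–Serre lemma for Hilbert modular forms are not vendored (facts wanted).  Size M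
conditional on named facts / L. [cite: Langlands1980, Tunnell1981, Wiles1988 §1,
DeligneSerre1974 Lemme 6.11, Serre1977 §16.4 (Fong–Swan), KhareWintenberger2009 §10] -/
theorem stub_levelOneModThree_modular : LevelOneModThreeGolden → LevelOneAt 3 := by
  sorry

/-- **STUB 2 — the small primes `p = 5, 7` at level one over the golden field** (transplant of
Khare–Wintenberger, Annals 169 (2009), Thm 1.1(i): level one for `p = 5, 7` over `ℚ`).  From the
three anchors (`MTAnchor`: nothing irreducible mod `2` at level one; `LevelOneModThreeGolden`:
solvable images mod `3` at level one; `SchoofAnchor`: no irreducible weight-two level-one `2`-adic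
`ρ`), every irreducible totally odd level-one `ρ̄` mod `5` or mod `7` over `F` is modular.  Paper
route: Serre weight `k(ρ̄) ≤ p + 1` up to twist; minimal crystalline / weight-two lifts into
strictly compatible systems (KW2009 Thms 4.1, 5.1 over the totally real `F`: Taylor's potential
modularity + Kisin/BLGGT lifting); weight-two level-one systems are killed by `SchoofAnchor`
(their `2`-adic member is crystalline `[0,1]` at `(2)` and unramified outside `2`), prime-level
semistable corners `Γ₀(𝔭)`, `𝔭 ∣ 5, 7`, by Schoof-type non-existence of semistable abelian
varieties / weight-two Hilbert newforms of level norm `< 31` over `ℚ(√5)` (Schoof2011; the first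
parallel-weight-two cuspidal Hilbert newform over `ℚ(√5)` has level norm `31`), the remaining
weights are switched to residual characteristic `2` or `3` where `MTAnchor` (⇒ reducible ⇒
Skinner–Wiles, ordinary at the split auxiliary prime) resp. the mod-`3` anchor apply, and
modularity is propagated back by modularity lifting.  Why it might fail: an MLT corner at the
inert prime `3`/`7` or at ramified `√5` outside Fontaine–Laffaille / potentially-diagonalisable
range; a semistable corner `𝔭 ∣ 5, 7` whose Schoof-type non-existence is not in print (route's
flagged risk).  Size XL. [cite: KhareWintenberger2009Annals Thm 1.1, KhareWintenberger2009 Thms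
3.2/4.1/5.1, Schoof2003, Schoof2011, KisinModuli2009, SkinnerWiles1999, GeeLiuSavitt2015] -/
theorem stub_levelOneFiveSeven :
    MTAnchor → LevelOneModThreeGolden → SchoofAnchor → LevelOneAt 5 ∧ LevelOneAt 7 := by
  sorry

/-- **STUB 3 — Khare's weight-cycle induction step over the golden field** (transplant of
Khare2006, Duke 134, Thm 1.1 / KW2009 Thm 3.2 + §§7–8): for a prime `P > 7`, level-one Serre over
`F` at every prime `p < P` implies level-one Serre at `P`.  Paper route: for `ρ̄` mod `P` of level
one and Serre weight `k ≤ P + 1` (up to twist), lift minimally to a weight-two compatible system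
of level `P` with nebentypus `ω^{k-2}` (KW Thm 5.1-type lift over `F`, auxiliary data at primes
SPLIT in `F`, i.e. `≡ ±1 (mod 5)`, with the explicit prime-distribution estimates of KW §7–8 /
Khare §5 restricted to split primes); reduce at a smaller prime `ℓ < P` chosen by the weight-cycle
bookkeeping so that the mod-`ℓ` representation has level one and smaller weight; it is modular by
the hypothesis (or reducible ⇒ Skinner–Wiles at an ordinary split prime, or weight-two level-one ⇒
killed by `SchoofAnchor`, or lands mod `2` ⇒ `MTAnchor`); modularity lifting (pot-BT at the target
prime: KisinModuli2009 / GeeKisin2014; crystalline low weight at split primes: BLGGT; weight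
bookkeeping at the inert primes `3, 7` and at `√5`: GeeLiuSavitt2015) carries modularity back
along the system to `ρ̄`.  Why it might fail: the KW §7 inequalities restricted to split primes may
leave finitely many `P` uncovered (a finite computation plus a Ramaré–Rumely-type bound is
claimed, not done); adequacy / dihedral degenerations at small `ℓ`.  Size XL.
[cite: Khare2006 Thm 1.1 §§3–5, KhareWintenberger2009 Thm 3.2 §§7–8, KhareWintenberger2009II
Thms 4.1/5.1, KisinModuli2009, GeeKisin2014, BarnetLambGeeGeraghtyTaylor2014, GeeLiuSavitt2015,
SkinnerWiles1999, DieulefaitPacetti2023 §1] -/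
theorem stub_weightCycleStep :
    MTAnchor → SchoofAnchor → ∀ P : ℕ, P.Prime → 7 < P →
      (∀ p : ℕ, p.Prime → p < P → LevelOneAt p) → LevelOneAt P := by
  sorry

/-! ## 2. The stub statements as named propositions (the composition's hypotheses, by name) -/

namespace _Goal

/-- The statement of `stub_levelOneModThree_modular`, as a named `Prop` (literally its type). [folklore] -/
def stub_levelOneModThree_modular : Prop :=
  type_of% @Summit.Langlands.Langlands.Cruxes.WeightCyclesGolden.Birth.stub_levelOneModThree_modular

/-- The statement of `stub_levelOneFiveSeven`, as a named `Prop` (literally its type). [folklore] -/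
def stub_levelOneFiveSeven : Prop :=
  type_of% @Summit.Langlands.Langlands.Cruxes.WeightCyclesGolden.Birth.stub_levelOneFiveSeven

/-- The statement of `stub_weightCycleStep`, as a named `Prop` (literally its type). [folklore] -/
def stub_weightCycleStep : Prop :=
  type_of% @Summit.Langlands.Langlands.Cruxes.WeightCyclesGolden.Birth.stub_weightCycleStep

end _Goal

/-! ## 3. The composition (kernel-checked; no `sorry` below this line) -/

/-- `p = 2` is vacuous: by the Moon–Taguchi anchor there is no irreducible level-one `ρ̄` mod `2`
over the golden field. [folklore] -/
theorem levelOneAt_two_of_MTAnchor (hMT : MTAnchor) : LevelOneAt 2 := by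
  intro _ F _ _ hF h5 k _ _ _ _ _ ρ hirr _hodd hunr
  exact absurd hirr (hMT F hF h5 k ρ hunr)

/-- Strong induction on the residual characteristic assembling the three stub statements into
`∀ p prime, LevelOneAt p`: `p = 2` vacuous (`MTAnchor`), `p = 3` stub 1, `p ∈ {5, 7}` stub 2,
`p > 7` stub 3 with the induction hypothesis; `4, 6` are not prime. [folklore] -/
theorem levelOneAt_all
    (h₁ : LevelOneModThreeGolden → LevelOneAt 3)
    (h₂ : MTAnchor → LevelOneModThreeGolden → SchoofAnchor → LevelOneAt 5 ∧ LevelOneAt 7)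
    (h₃ : MTAnchor → SchoofAnchor → ∀ P : ℕ, P.Prime → 7 < P →
      (∀ p : ℕ, p.Prime → p < P → LevelOneAt p) → LevelOneAt P)
    (hMT : MTAnchor) (hL3 : LevelOneModThreeGolden) (hS : SchoofAnchor) :
    ∀ p : ℕ, p.Prime → LevelOneAt p := by
  intro p
  induction p using Nat.strong_induction_on with
  | _ P ih =>
    intro hP
    by_cases hbig : 7 < P
    · exact h₃ hMT hS P hP hbig (fun q hq hlt => ih q hlt hq)
    · have hP2 : 2 ≤ P := hP.two_le
      have hP7 : P ≤ 7 := Nat.le_of_not_lt hbig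
      interval_cases P
      · exact levelOneAt_two_of_MTAnchor hMT
      · exact h₁ hL3
      · exact absurd hP (by decide)
      · exact (h₂ hMT hL3 hS).1
      · exact absurd hP (by decide)
      · exact (h₂ hMT hL3 hS).2

/-- **THE COMPOSITION (the skeleton theorem).** The three stub statements, taken BY NAME
(`_Goal.stub_*` = literally the types of the `stub_*`), imply the crux
`Summit.Langlands.Langlands.Theses.GoldenFieldSerre.WeightCyclesGolden` BY NAME: unfold the named
hypotheses, assemble `∀ p prime, LevelOneAt p` by `levelOneAt_all`, and re-order binders with
`crux_iff`. No `sorry`, no axiom beyond the whitelist. [folklore] -/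
theorem WeightCyclesGolden_of (h₁ : _Goal.stub_levelOneModThree_modular)
    (h₂ : _Goal.stub_levelOneFiveSeven) (h₃ : _Goal.stub_weightCycleStep) :
    Summit.Langlands.Langlands.Theses.GoldenFieldSerre.WeightCyclesGolden := by
  unfold _Goal.stub_levelOneModThree_modular at h₁
  unfold _Goal.stub_levelOneFiveSeven at h₂
  unfold _Goal.stub_weightCycleStep at h₃
  exact crux_iff.mpr (levelOneAt_all h₁ h₂ h₃)

/-- By-name sanity check (an `example`, not a declaration of the file): the open stubs feed the
composition as they stand, so the crux holds modulo exactly the three `stub_*` sorries. -/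
example : Summit.Langlands.Langlands.Theses.GoldenFieldSerre.WeightCyclesGolden :=
  WeightCyclesGolden_of stub_levelOneModThree_modular stub_levelOneFiveSeven stub_weightCycleStep

end Summit.Langlands.Langlands.Cruxes.WeightCyclesGolden.Birth

end
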